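import Mathlib.Data.Nat.Factorization.Basic
import Mathlib.Algebra.BigOperators.Field
import Mathlib.Data.Real.Basic
import Mathlib.Tactic.Linarith
import HarnessLib

/-!
# The layered counting identity over the prime factors in a designated range

Trunk AntSieve, tooling toward the named fact `Literature.NumberTheory.Sieve.weakDHL_three_two_of_GEH`
(D. H. J. Polymath, Res. Math. Sci. 1:12 (2014) = arXiv:1407.4897, Theorem 3.2(xii)).  For the `Σ₃`
step of the proof of Theorem 3.6(ii) (§4.5, p. 17: decomposition of an almost-prime weight into
Dirichlet convolutions `α ⋆ β` with `β` the primes of one short range, to which Claim 2.6 applies) one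
needs an EXACT identity valid also for integers with repeated prime factors in the top range `P`.
Writing `Ω_P(n) = Σ_{p ∈ P} v_p(n)` for the number of prime factors of `n` in `P` counted with
multiplicity, the elementary identity `Σ_{p ∈ P} Σ_{1 ≤ e ≤ v_p(n)} 1 = Ω_P(n)` gives, for every weight
of the form `Θ · Ψ(Ω_P(n))` with `Θ` blind to the exponents at the primes of `P`,
`Σ_{e ≥ 1} Σ_{p ∈ P, p^e ∣ n} Θ Ψ(Ω_P(n/p^e) + e) / (Ω_P(n/p^e) + e) = Θ Ψ(Ω_P(n))`
(`sum_layers_eq`): the `e`-th layer is the Dirichlet convolution of `m ↦ Θ Ψ(Ω_P(m)+e)/(Ω_P(m)+e)`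
with the indicator of the `e`-th powers of the primes of `P`.

## References

* [Polymath8b2014] D. H. J. Polymath, Res. Math. Sci. 1 (2014), Art. 12 = arXiv:1407.4897,
  §4.5, p. 17 (the decomposition behind "assigning `A_{j_r}` to be `β`").
-/

open Finset

namespace Literature.NumberTheory.Sieve

/-- `Ω_P(n)`: the number of prime factors of `n` in `P`, counted with multiplicity. [folklore] -/
def omegaIn (P : Finset ℕ) (n : ℕ) : ℕ := ∑ p ∈ P, n.factorization p

/-- Removing `p^e` (`e ≤ v_p(n)`, `p ∈ P` prime) lowers `Ω_P` by exactly `e`. [folklore] -/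
theorem omegaIn_div_pow {P : Finset ℕ} (hP : ∀ p ∈ P, p.Prime) {n p e : ℕ} (hn : n ≠ 0) (hp : p ∈ P)
    (he : e ≤ n.factorization p) : omegaIn P (n / p ^ e) + e = omegaIn P n := by
  have hpp := hP p hp
  have hdvd : p ^ e ∣ n := (hpp.pow_dvd_iff_le_factorization hn).2 he
  have hf : ∀ q, (n / p ^ e).factorization q = n.factorization q - (if p = q then e else 0) := by
    intro q
    rw [Nat.factorization_div hdvd, Finsupp.tsub_apply, Nat.factorization_pow, hpp.factorization,
      Finsupp.smul_apply, Finsupp.single_apply, smul_eq_mul]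
    split_ifs <;> simp
  unfold omegaIn
  rw [← Finset.add_sum_erase P _ hp, ← Finset.add_sum_erase P _ hp, hf p, if_pos rfl]
  have hrest : ∑ q ∈ P.erase p, (n / p ^ e).factorization q = ∑ q ∈ P.erase p, n.factorization q :=
    Finset.sum_congr rfl fun q hq => by
      rw [hf q, if_neg (Finset.ne_of_mem_erase hq).symm, Nat.sub_zero]
  rw [hrest]
  omega

/-- The number of layers through which `p` sees `n`: `#{e ∈ [1, E] : p^e ∣ n} = min(v_p(n), E)`. [folklore] -/
theorem card_filter_pow_dvd {n p : ℕ} (hp : p.Prime) (hn : n ≠ 0) (E : ℕ) :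
    #((Icc 1 E).filter fun e => p ^ e ∣ n) = min (n.factorization p) E := by
  have : (Icc 1 E).filter (fun e => p ^ e ∣ n) = Icc 1 (min (n.factorization p) E) := by
    ext e
    simp only [Finset.mem_filter, Finset.mem_Icc, hp.pow_dvd_iff_le_factorization hn]
    omega
  rw [this, Nat.card_Icc]
  omega

/-- **The layered counting identity.**  Let `P` be a finite set of primes, `n ≠ 0` with
`Ω_P(n) ≥ 1`, `E ≥ v_p(n)` for all `p ∈ P`, and `Ψ : ℕ → ℝ`.  Then
`Σ_{e ∈ [1,E]} Σ_{p ∈ P, p^e ∣ n} Ψ(Ω_P(n/p^e) + e) / (Ω_P(n/p^e) + e) = Ψ(Ω_P(n))`.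
[cite: Polymath8b2014, §4.5, p. 17] -/
theorem sum_layers_eq {P : Finset ℕ} (hP : ∀ p ∈ P, p.Prime) {n : ℕ} (hn : n ≠ 0)
    (hΩ : 1 ≤ omegaIn P n) {E : ℕ} (hE : ∀ p ∈ P, n.factorization p ≤ E) (Ψ : ℕ → ℝ) :
    ∑ e ∈ Icc 1 E, ∑ p ∈ P.filter (fun p => p ^ e ∣ n),
      Ψ (omegaIn P (n / p ^ e) + e) / (omegaIn P (n / p ^ e) + e : ℕ) = Ψ (omegaIn P n) := by
  -- every term equals `Ψ(Ω)/Ω`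
  have hterm : ∀ e ∈ Icc 1 E, ∀ p ∈ P.filter (fun p => p ^ e ∣ n),
      Ψ (omegaIn P (n / p ^ e) + e) / (omegaIn P (n / p ^ e) + e : ℕ) = Ψ (omegaIn P n) / (omegaIn P n : ℕ) := by
    intro e _ p hp
    rw [Finset.mem_filter] at hp
    have he : e ≤ n.factorization p := ((hP p hp.1).pow_dvd_iff_le_factorization hn).1 hp.2
    rw [omegaIn_div_pow hP hn hp.1 he]
  rw [Finset.sum_congr rfl fun e he => Finset.sum_congr rfl (hterm e he)]
  simp only [Finset.sum_const, nsmul_eq_mul]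
  -- `Σ_e #{p : p^e ∣ n} = Σ_p #{e : p^e ∣ n} = Σ_p v_p(n) = Ω`
  have hcount : ∑ e ∈ Icc 1 E, (#(P.filter fun p => p ^ e ∣ n) : ℝ) = (omegaIn P n : ℕ) := by
    have h1 : ∑ e ∈ Icc 1 E, (#(P.filter fun p => p ^ e ∣ n) : ℝ) =
        ∑ p ∈ P, (#((Icc 1 E).filter fun e => p ^ e ∣ n) : ℝ) := by
      simp only [Finset.card_eq_sum_ones, Nat.cast_sum, Finset.sum_filter]
      push_cast
      exact Finset.sum_comm
    rw [h1, omegaIn]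
    push_cast
    refine Finset.sum_congr rfl fun p hp => ?_
    rw [card_filter_pow_dvd (hP p hp) hn E, min_eq_left (hE p hp)]
  rw [← Finset.sum_mul, hcount]
  have hΩ0 : ((omegaIn P n : ℕ) : ℝ) ≠ 0 := by
    have : (1 : ℝ) ≤ (omegaIn P n : ℕ) := by exact_mod_cast hΩ
    intro h; rw [h] at this; exact absurd this (by norm_num)
  rw [mul_comm, div_mul_cancel₀ _ hΩ0]

end Literature.NumberTheory.Sieve
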